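import Summits.Ventures.CertifiedManyBodySolver.Certificates.HubbardSquare_n7o8_obsOP1E_TLB0gbD2_box1corners_box3d
import Summits.Ventures.CertifiedManyBodySolver.Certificates.HubbardSquare_n7o8_obsOP1Etf_TLT2ugbTF_tp0_j252942
import HarnessLib
import HarnessLib.Audit

/-!
# Ventures/CertifiedManyBodySolver — Certificates/HubbardSquare_n7o8_obsOP1Etw_TLT2ugbTF_box1corners.lean

HONEST FRAMING: first certified bounds on pairing observables; positivity-scale pair-LRO CEILINGS (a ceiling never speaks to
the PRESENCE of order); not informative vs print; not a superconductivity verdict; no phase sentence. CANDIDATE device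
(hubbard-obs item «BOX1-OP1E-CORNERS», UNION level). Zero compute, no `sorry`, no new axiom; nothing is asserted unconditionally.
Cell hubbard-algo (D-0042 crew (5)), seat hubbard-box-eng-3 (`prover-hubbard-box-eng-3-g7-0`).

THE FOUR-ANCHOR MIX FOR TWISTED (D₄ × flip, gauge-twisted) ONE-POINT ROWS — the device of `…_obsOP1E_TLB0gbD2_box1corners[_box3d].lean`
for the row shape of the registry's V20 / row-50 class (`cert_obsOP1Etw_pairamp_TLT2ugbTF_…`: window `op1eWindow_TLT2ugbTF`, averaging
family `twistedFlipSpaceGroupUnitary op1eTw_TLT2ugbTF`, ONE total-filling term `μ₀(Re⟨ζ,N̂ζ⟩/L² − 7/8)`): (§1) the `U`-generic row shape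
`OP1ETwRowAtU tp U c κ u μ₀` and its Koma–Tasaki reading AT ANY DENSITY `n` (`OP1ETwRowAtU.ceilingAt_density`, hubbard-obs-p1's
`liminf_pairFieldLRO_le_sq_of_onePoint_variational_bound_TT'` + `re_orbitState_twistedFlipSpaceGroupUnitary_localPairAt`); (§2) the mixed row
`OP1ETwRowAtU.mix4_row` (pencil moments of the affine `(t′,U) ↦ H_L(1,t′,U)` cancel — `TTPrimeFree.re_expect_tt_affine`); (§3) the generic
BOX theorem `box1TwBox_pairLROCeilingAt_of_cornerRows`: four corner rows + a cap at density `n` that is the tensor interpolant of corner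
references ⇒ `ObsPairLROCeilingAt t′ U n c′` with `c′ ≥ m²`, `m` ≥ every transported corner constant `|c_v + κ_v(u_v − T_v) + μ_v(n − 7/8)|`.
The literal instantiation (UNION-level corner certificates of «BOX1-OP1E-CORNERS-UNION») follows in a sibling file.
References: T. Koma, H. Tasaki, J. Stat. Phys. 76 (1994) 745, Theorem 5 [KomaTasaki1994]; R. B. Israel, *Convexity in the Theory of
Lattice Gases* (1979) Thm I.3.4 [Israel1979]; H. Xu et al., Science 384 (2024) eadh7691, eq. (1) [XuEtAl2024].
-/

noncomputable section

namespace Summit.Ventures.CertifiedManyBodySolver.Certificates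

open Matrix Complex Finset Literature.MathematicalPhysics.QuantumLattice Literature.Probability.LatticeModels
open Literature.MathematicalPhysics.QuantumLattice.HubbardWave0 ThermodynamicLimit Filter Topology
open Literature.MathematicalPhysics.QuantumManyBody.StateRelaxation
open Summit.Ventures.CertifiedManyBodySolver.Observables
open Summit.Ventures.CertifiedManyBodySolver.Transport
open scoped ComplexOrder ComplexConjugate BigOperators
open Set

/-! ### §1 The twisted one-point row shape at `(t′, U)` and its reading at any density -/

/-- **The TWISTED OP1-E one-point ROW at `(1, tp, U)` with literals `(c, κ, u, μ₀)`** (V20-class program: window `op1eWindow_TLT2ugbTF`,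
averaging family `twistedFlipSpaceGroupUnitary op1eTw_TLT2ugbTF`, objective `−Φ₀`, ONE total-filling term with reference `7/8`): for every torus
side `L ≥ 3` on which the window projects injectively and every UNIT vector `ζ`,
`c + μ₀ (Re⟨ζ,N̂ζ⟩/L² − 7/8) + κ (u − Re⟨ζ,H_L(1,tp,U)ζ⟩/L²) ≤ Re ω̄^{tw}_ζ(Γ(ι_L)(−Γ(incl)Φ₀))` — the shape of `cert_obsOP1Etw_pairamp_TLT2ugbTF_sqU8n7o8tp0_c354_up`
with `(tp, U)` and the literals abstracted. [cite: KomaTasaki1994, Theorem 5] -/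
def OP1ETwRowAtU (tp U c κ u μ₀ : ℝ) : Prop :=
  ∀ (L : ℕ) [NeZero L]
    (hInj : Set.InjOn (Torus.proj (d := 2) L) ↑op1eWindow_TLT2ugbTF)
    (ζ : Fock (Orb (FermionTorus 2 L))), 3 ≤ L → star ζ ⬝ᵥ ζ = 1 →
    c + μ₀ * ((star ζ ⬝ᵥ ((totalNumber : Matrix (Finset (Orb (FermionTorus 2 L))) _ ℂ) *ᵥ ζ)).re / (L : ℝ) ^ 2 - (7 / 8 : ℝ)) +
      κ * (u - (star ζ ⬝ᵥ (hubbardTorusTT' L 1 tp U *ᵥ ζ)).re / (L : ℝ) ^ 2) ≤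
      (orbitState (twistedFlipSpaceGroupUnitary op1eTw_TLT2ugbTF) ζ (fermionEmbed (PolySite.toTorusEmb L hInj)
        (-(fermionEmbed (PolySite.incl pairRegion_subset_op1eWindow_TLT2ugbTF)
          (localPairAt (insert (0 : Site 2) unitSteps) dWaveFormFactor 0))))).re

/-- **Koma–Tasaki reading of ONE twisted row at `(tp, U)` AT DENSITY `n`**: `κ ≥ 0`, `U ≥ 0`, `0 ≤ n < 2` and a CAP `e(1,tp,U;n) ≤ T` give
`ObsPairLROCeilingAt tp U n c′` for every rational `c′ ≥ (c − κ(T − u) + μ₀(n − 7/8))²` (the filling multiplier's Lagrangian sensitivity carries the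
row to density `n`; hubbard-obs-p1's tower discharger + the twisted-flip orbit identity). A ceiling; says nothing about presence. [cite: KomaTasaki1994, Theorem 5] -/
theorem OP1ETwRowAtU.ceilingAt_density {tp U c κ u μ₀ : ℝ} (h : OP1ETwRowAtU tp U c κ u μ₀) (hκ : 0 ≤ κ) (hU : 0 ≤ U)
    {n T : ℝ} (hn0 : 0 ≤ n) (hn2 : n < 2) (hT : energyDensityTT' 1 tp U n ≤ T)
    {c' : ℚ} (hc' : (c - κ * (T - u) + μ₀ * (n - 7 / 8)) ^ 2 ≤ ((c' : ℚ) : ℝ)) :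
    ObsPairLROCeilingAt tp U n c' := by
  classical
  obtain ⟨L₀, hL₀⟩ := exists_forall_le_injOn_proj (d := 2) op1eWindow_TLT2ugbTF
  have hInj : ∀ L : ℕ, max L₀ 3 ≤ L → Set.InjOn (Torus.proj (d := 2) L) ↑op1eWindow_TLT2ugbTF :=
    fun L hL => hL₀ L (le_trans (le_max_left _ _) hL)
  intro ψ hψ hψ1
  have hc'' : (c - κ * (T - u) + (∑ _σ : Fin 2, μ₀) * (n / 2 - 7 / 8 / 2)) ^ 2 ≤ ((c' : ℚ) : ℝ) := by
    rw [Fin.sum_univ_two, show (μ₀ + μ₀) * (n / 2 - 7 / 8 / 2) = μ₀ * (n - 7 / 8) by ring]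
    exact hc'
  refine (liminf_pairFieldLRO_le_sq_of_onePoint_variational_bound_TT' dWaveFormFactor 1 tp hU hn0 hn2
    (c := c) (A := κ * (T - u)) (u := T) (ν := 7 / 8 / 2) (fun _ => μ₀) hκ hT (max L₀ 3) ?_ ψ hψ hψ1).trans hc''
  intro L _ hL ζ hζ
  have h3 : 3 ≤ L := le_trans (le_max_right _ _) hL
  have r := h L (hInj L hL) ζ h3 hζ
  rw [fermionEmbed_neg, map_neg, Complex.neg_re,
    re_orbitState_twistedFlipSpaceGroupUnitary_localPairAt op1eTw_TLT2ugbTF_nonempty pairRegion_subset_op1eWindow_TLT2ugbTF (hInj L hL) ζ,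
    ← sum_spin_filling_eq_total ζ μ₀ (7 / 8)] at r
  convert r using 1
  ring

/-- **Moving the energy reference of a twisted row is free, for every ζ**: reference `u ↦ u′`, constant `c ↦ c + κ(u − u′)`.
[cite: KomaTasaki1994, Theorem 5] -/
theorem OP1ETwRowAtU.reanchor {tp U c κ u μ₀ : ℝ} (h : OP1ETwRowAtU tp U c κ u μ₀) (u' : ℝ) :
    OP1ETwRowAtU tp U (c + κ * (u - u')) κ u' μ₀ := by
  intro L _ hInj ζ hL hζ
  have r := h L hInj ζ hL hζ
  have e : c + κ * (u - u') + μ₀ * ((star ζ ⬝ᵥ ((totalNumber : Matrix (Finset (Orb (FermionTorus 2 L))) _ ℂ) *ᵥ ζ)).re /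
        (L : ℝ) ^ 2 - (7 / 8 : ℝ)) + κ * (u' - (star ζ ⬝ᵥ (hubbardTorusTT' L 1 tp U *ᵥ ζ)).re / (L : ℝ) ^ 2) =
      c + μ₀ * ((star ζ ⬝ᵥ ((totalNumber : Matrix (Finset (Orb (FermionTorus 2 L))) _ ℂ) *ᵥ ζ)).re /
        (L : ℝ) ^ 2 - (7 / 8 : ℝ)) + κ * (u - (star ζ ⬝ᵥ (hubbardTorusTT' L 1 tp U *ᵥ ζ)).re / (L : ℝ) ^ 2) := by ring
  rw [e]; exact r

/-! ### §2 The four-anchor mixed twisted row (every ζ; pencil cancellation) -/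

/-- **The FOUR-ANCHOR MIXED twisted row at `θ = (tp, U)`**: rows at `θ_v`, weights `w_v ≥ 0`, `Σ w_v = W > 0`, `Σ w_v κ_v = 1`, both `κ`-weighted
pencil moments cancelled ⇒ `OP1ETwRowAtU tp U ((Σ w_v(c_v + κ_v u_v) − T)/W) (1/W) T ((Σ w_v μ_v)/W)` for every reference `T`. Pure algebra
(`TTPrimeFree.re_expect_tt_affine`). [cite: KomaTasaki1994, Theorem 5] [cite: XuEtAl2024, eq. (1)] -/
theorem OP1ETwRowAtU.mix4_row
    {tp₁ U₁ c₁ κ₁ u₁ tp₂ U₂ c₂ κ₂ u₂ tp₃ U₃ c₃ κ₃ u₃ tp₄ U₄ c₄ κ₄ u₄ μ₁ μ₂ μ₃ μ₄ : ℝ}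
    (h₁ : OP1ETwRowAtU tp₁ U₁ c₁ κ₁ u₁ μ₁) (h₂ : OP1ETwRowAtU tp₂ U₂ c₂ κ₂ u₂ μ₂)
    (h₃ : OP1ETwRowAtU tp₃ U₃ c₃ κ₃ u₃ μ₃) (h₄ : OP1ETwRowAtU tp₄ U₄ c₄ κ₄ u₄ μ₄)
    {tp U w₁ w₂ w₃ w₄ : ℝ} (hw₁ : 0 ≤ w₁) (hw₂ : 0 ≤ w₂) (hw₃ : 0 ≤ w₃) (hw₄ : 0 ≤ w₄)
    (hW : 0 < w₁ + w₂ + w₃ + w₄)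
    (hS : w₁ * κ₁ + w₂ * κ₂ + w₃ * κ₃ + w₄ * κ₄ = 1)
    (hK : w₁ * κ₁ * (tp - tp₁) + w₂ * κ₂ * (tp - tp₂) + w₃ * κ₃ * (tp - tp₃) + w₄ * κ₄ * (tp - tp₄) = 0)
    (hD : w₁ * κ₁ * (U₁ - U) + w₂ * κ₂ * (U₂ - U) + w₃ * κ₃ * (U₃ - U) + w₄ * κ₄ * (U₄ - U) = 0) (T : ℝ) :
    OP1ETwRowAtU tp U
      ((w₁ * (c₁ + κ₁ * u₁) + w₂ * (c₂ + κ₂ * u₂) + w₃ * (c₃ + κ₃ * u₃) + w₄ * (c₄ + κ₄ * u₄) - T) / (w₁ + w₂ + w₃ + w₄))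
      (1 / (w₁ + w₂ + w₃ + w₄)) T ((w₁ * μ₁ + w₂ * μ₂ + w₃ * μ₃ + w₄ * μ₄) / (w₁ + w₂ + w₃ + w₄)) := by
  set W := w₁ + w₂ + w₃ + w₄ with hWdef
  intro L _ hInj ζ hL hζ
  have r₁ := h₁ L hInj ζ hL hζ
  have r₂ := h₂ L hInj ζ hL hζ
  have r₃ := h₃ L hInj ζ hL hζ
  have r₄ := h₄ L hInj ζ hL hζ
  have e₁ := TTPrimeFree.re_expect_tt_affine (L := L) 1 tp U tp₁ U₁ ζ
  have e₂ := TTPrimeFree.re_expect_tt_affine (L := L) 1 tp U tp₂ U₂ ζ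
  have e₃ := TTPrimeFree.re_expect_tt_affine (L := L) 1 tp U tp₃ U₃ ζ
  have e₄ := TTPrimeFree.re_expect_tt_affine (L := L) 1 tp U tp₄ U₄ ζ
  simp only [Literature.MathematicalPhysics.QuantumLattice.expect] at e₁ e₂ e₃ e₄
  rw [e₁] at r₁; rw [e₂] at r₂; rw [e₃] at r₃; rw [e₄] at r₄
  set E := (star ζ ⬝ᵥ (hubbardTorusTT' L 1 tp U *ᵥ ζ)).re with hE
  set Kd := (star ζ ⬝ᵥ (TTPrimeFree.diagHop L *ᵥ ζ)).re with hKd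
  set Dd := (star ζ ⬝ᵥ ((∑ x : FermionTorus 2 L, numberOp x 0 * numberOp x 1) *ᵥ ζ)).re with hDd
  set R := (orbitState (twistedFlipSpaceGroupUnitary op1eTw_TLT2ugbTF) ζ (fermionEmbed (PolySite.toTorusEmb L hInj)
      (-(fermionEmbed (PolySite.incl pairRegion_subset_op1eWindow_TLT2ugbTF)
        (localPairAt (insert (0 : Site 2) unitSteps) dWaveFormFactor 0))))).re with hR
  set Nt := (star ζ ⬝ᵥ ((totalNumber : Matrix (Finset (Orb (FermionTorus 2 L))) _ ℂ) *ᵥ ζ)).re with hNt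
  have hL2 : (0 : ℝ) < (L : ℝ) ^ 2 := by
    have : (3 : ℝ) ≤ (L : ℝ) := by exact_mod_cast hL
    positivity
  have s₁ := mul_le_mul_of_nonneg_left r₁ hw₁
  have s₂ := mul_le_mul_of_nonneg_left r₂ hw₂
  have s₃ := mul_le_mul_of_nonneg_left r₃ hw₃
  have s₄ := mul_le_mul_of_nonneg_left r₄ hw₄
  set LW := (w₁ * (c₁ + κ₁ * u₁) + w₂ * (c₂ + κ₂ * u₂) + w₃ * (c₃ + κ₃ * u₃) + w₄ * (c₄ + κ₄ * u₄) - T) +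
      (w₁ * μ₁ + w₂ * μ₂ + w₃ * μ₃ + w₄ * μ₄) * (Nt / (L : ℝ) ^ 2 - 7 / 8) + (T - E / (L : ℝ) ^ 2) with hLW
  have hsum : LW =
      w₁ * (c₁ + μ₁ * (Nt / (L : ℝ) ^ 2 - 7 / 8) + κ₁ * (u₁ - (E + (tp - tp₁) * Kd + (U₁ - U) * Dd) / (L : ℝ) ^ 2)) +
      w₂ * (c₂ + μ₂ * (Nt / (L : ℝ) ^ 2 - 7 / 8) + κ₂ * (u₂ - (E + (tp - tp₂) * Kd + (U₂ - U) * Dd) / (L : ℝ) ^ 2)) +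
      w₃ * (c₃ + μ₃ * (Nt / (L : ℝ) ^ 2 - 7 / 8) + κ₃ * (u₃ - (E + (tp - tp₃) * Kd + (U₃ - U) * Dd) / (L : ℝ) ^ 2)) +
      w₄ * (c₄ + μ₄ * (Nt / (L : ℝ) ^ 2 - 7 / 8) + κ₄ * (u₄ - (E + (tp - tp₄) * Kd + (U₄ - U) * Dd) / (L : ℝ) ^ 2)) := by
    rw [hLW]
    linear_combination (E / (L : ℝ) ^ 2) * hS + (Kd / (L : ℝ) ^ 2) * hK + (Dd / (L : ℝ) ^ 2) * hD
  have hLW_le : LW ≤ W * R := by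
    rw [hsum, hWdef]
    linarith [s₁, s₂, s₃, s₄]
  have goal_eq : (w₁ * (c₁ + κ₁ * u₁) + w₂ * (c₂ + κ₂ * u₂) + w₃ * (c₃ + κ₃ * u₃) + w₄ * (c₄ + κ₄ * u₄) - T) / W +
      (w₁ * μ₁ + w₂ * μ₂ + w₃ * μ₃ + w₄ * μ₄) / W * (Nt / (L : ℝ) ^ 2 - 7 / 8) +
      1 / W * (T - E / (L : ℝ) ^ 2) = LW / W := by
    rw [hLW]
    field_simp
  rw [goal_eq, div_le_iff₀ hW]
  linarith [hLW_le]

/-! ### §3 The box theorem for twisted corner rows (generic literals; the cap at density `n` as a hypothesis) -/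

/-- **THE BOX THEOREM for twisted rows (generic literals).** Four twisted OP1-E rows at the outer corners of the n = 7/8 face of box #1
(`0 < κ_v ≤ Kκ`), a point `(tp, U)` of the face, a density `0 ≤ n < 2`, corner references AT DENSITY `n`, `T_v`, whose tensor interpolant
caps `e(1,tp,U;n)` (hypothesis `hT`), and `m ≥` every `|c_v + κ_v(u_v − T_v) + μ_v(n − 7/8)|` give `ObsPairLROCeilingAt tp U n c′` for every
rational `c′ ≥ m²` — the mixed row (tensor weights / κ_v) read at density `n`; its constant is a weighted MEAN of the per-corner constants.
[cite: KomaTasaki1994, Theorem 5] [cite: Israel1979, Thm. I.3.4] -/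
theorem box1TwBox_pairLROCeilingAt_of_cornerRows
    {c₁ κ₁ u₁ μ₁ c₂ κ₂ u₂ μ₂ c₃ κ₃ u₃ μ₃ c₄ κ₄ u₄ μ₄ Kκ m : ℝ}
    (hSW : OP1ETwRowAtU (-3/10) (15/2) c₁ κ₁ u₁ μ₁) (hNW : OP1ETwRowAtU (-1/5) (15/2) c₂ κ₂ u₂ μ₂)
    (hSE : OP1ETwRowAtU (-3/10) (17/2) c₃ κ₃ u₃ μ₃) (hNE : OP1ETwRowAtU (-1/5) (17/2) c₄ κ₄ u₄ μ₄)
    (hκ₁ : 0 < κ₁) (hκ₂ : 0 < κ₂) (hκ₃ : 0 < κ₃) (hκ₄ : 0 < κ₄)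
    (hK₁ : κ₁ ≤ Kκ) (hK₂ : κ₂ ≤ Kκ) (hK₃ : κ₃ ≤ Kκ) (hK₄ : κ₄ ≤ Kκ)
    {tp U n T₁ T₂ T₃ T₄ : ℝ} (htp : -3/10 ≤ tp ∧ tp ≤ -1/5) (hU : 15/2 ≤ U ∧ U ≤ 17/2) (hn0 : 0 ≤ n) (hn2 : n < 2)
    (hT : energyDensityTT' 1 tp U n ≤
      10 * ((17/2 - U) * (-1/5 - tp)) * T₁ + 10 * ((17/2 - U) * (tp + 3/10)) * T₂ +
      10 * ((U - 15/2) * (-1/5 - tp)) * T₃ + 10 * ((U - 15/2) * (tp + 3/10)) * T₄)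
    (hg₁ : -m ≤ c₁ + κ₁ * (u₁ - T₁) + μ₁ * (n - 7 / 8) ∧ c₁ + κ₁ * (u₁ - T₁) + μ₁ * (n - 7 / 8) ≤ m)
    (hg₂ : -m ≤ c₂ + κ₂ * (u₂ - T₂) + μ₂ * (n - 7 / 8) ∧ c₂ + κ₂ * (u₂ - T₂) + μ₂ * (n - 7 / 8) ≤ m)
    (hg₃ : -m ≤ c₃ + κ₃ * (u₃ - T₃) + μ₃ * (n - 7 / 8) ∧ c₃ + κ₃ * (u₃ - T₃) + μ₃ * (n - 7 / 8) ≤ m)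
    (hg₄ : -m ≤ c₄ + κ₄ * (u₄ - T₄) + μ₄ * (n - 7 / 8) ∧ c₄ + κ₄ * (u₄ - T₄) + μ₄ * (n - 7 / 8) ≤ m)
    {c' : ℚ} (hc' : m ^ 2 ≤ ((c' : ℚ) : ℝ)) :
    ObsPairLROCeilingAt tp U n c' := by
  obtain ⟨ht1, ht2⟩ := htp
  obtain ⟨hU1, hU2⟩ := hU
  have hKpos : 0 < Kκ := lt_of_lt_of_le hκ₁ hK₁
  have hU0 : (0:ℝ) ≤ U := by linarith
  set a₁ := 10 * ((17/2 - U) * (-1/5 - tp)) with ha₁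
  set a₂ := 10 * ((17/2 - U) * (tp + 3/10)) with ha₂
  set a₃ := 10 * ((U - 15/2) * (-1/5 - tp)) with ha₃
  set a₄ := 10 * ((U - 15/2) * (tp + 3/10)) with ha₄
  have ha₁0 : 0 ≤ a₁ := by rw [ha₁]; exact mul_nonneg (by norm_num) (mul_nonneg (by linarith) (by linarith))
  have ha₂0 : 0 ≤ a₂ := by rw [ha₂]; exact mul_nonneg (by norm_num) (mul_nonneg (by linarith) (by linarith))
  have ha₃0 : 0 ≤ a₃ := by rw [ha₃]; exact mul_nonneg (by norm_num) (mul_nonneg (by linarith) (by linarith))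
  have ha₄0 : 0 ≤ a₄ := by rw [ha₄]; exact mul_nonneg (by norm_num) (mul_nonneg (by linarith) (by linarith))
  have hsum1 : a₁ + a₂ + a₃ + a₄ = 1 := by rw [ha₁, ha₂, ha₃, ha₄]; ring
  have hw₁ : 0 ≤ a₁ / κ₁ := div_nonneg ha₁0 hκ₁.le
  have hw₂ : 0 ≤ a₂ / κ₂ := div_nonneg ha₂0 hκ₂.le
  have hw₃ : 0 ≤ a₃ / κ₃ := div_nonneg ha₃0 hκ₃.le
  have hw₄ : 0 ≤ a₄ / κ₄ := div_nonneg ha₄0 hκ₄.le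
  have hW : 0 < a₁ / κ₁ + a₂ / κ₂ + a₃ / κ₃ + a₄ / κ₄ := by
    have l₁ : a₁ / Kκ ≤ a₁ / κ₁ := div_le_div_of_nonneg_left ha₁0 hκ₁ hK₁
    have l₂ : a₂ / Kκ ≤ a₂ / κ₂ := div_le_div_of_nonneg_left ha₂0 hκ₂ hK₂
    have l₃ : a₃ / Kκ ≤ a₃ / κ₃ := div_le_div_of_nonneg_left ha₃0 hκ₃ hK₃
    have l₄ : a₄ / Kκ ≤ a₄ / κ₄ := div_le_div_of_nonneg_left ha₄0 hκ₄ hK₄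
    have e : a₁ / Kκ + a₂ / Kκ + a₃ / Kκ + a₄ / Kκ = 1 / Kκ := by
      rw [← add_div, ← add_div, ← add_div, hsum1]
    have hk : (0:ℝ) < 1 / Kκ := by positivity
    linarith
  have hS : a₁ / κ₁ * κ₁ + a₂ / κ₂ * κ₂ + a₃ / κ₃ * κ₃ + a₄ / κ₄ * κ₄ = 1 := by
    rw [div_mul_cancel₀ _ hκ₁.ne', div_mul_cancel₀ _ hκ₂.ne', div_mul_cancel₀ _ hκ₃.ne', div_mul_cancel₀ _ hκ₄.ne']
    exact hsum1
  have hKc : a₁ / κ₁ * κ₁ * (tp - (-3/10)) + a₂ / κ₂ * κ₂ * (tp - (-1/5)) + a₃ / κ₃ * κ₃ * (tp - (-3/10)) +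
      a₄ / κ₄ * κ₄ * (tp - (-1/5)) = 0 := by
    rw [div_mul_cancel₀ _ hκ₁.ne', div_mul_cancel₀ _ hκ₂.ne', div_mul_cancel₀ _ hκ₃.ne', div_mul_cancel₀ _ hκ₄.ne',
      ha₁, ha₂, ha₃, ha₄]
    ring
  have hD : a₁ / κ₁ * κ₁ * (15/2 - U) + a₂ / κ₂ * κ₂ * (15/2 - U) + a₃ / κ₃ * κ₃ * (17/2 - U) +
      a₄ / κ₄ * κ₄ * (17/2 - U) = 0 := by
    rw [div_mul_cancel₀ _ hκ₁.ne', div_mul_cancel₀ _ hκ₂.ne', div_mul_cancel₀ _ hκ₃.ne', div_mul_cancel₀ _ hκ₄.ne',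
      ha₁, ha₂, ha₃, ha₄]
    ring
  have hrow := OP1ETwRowAtU.mix4_row hSW hNW hSE hNE hw₁ hw₂ hw₃ hw₄ hW hS hKc hD (a₁ * T₁ + a₂ * T₂ + a₃ * T₃ + a₄ * T₄)
  have hκ : (0 : ℝ) ≤ 1 / (a₁ / κ₁ + a₂ / κ₂ + a₃ / κ₃ + a₄ / κ₄) := by positivity
  refine OP1ETwRowAtU.ceilingAt_density hrow hκ hU0 hn0 hn2 hT ?_
  set W := a₁ / κ₁ + a₂ / κ₂ + a₃ / κ₃ + a₄ / κ₄ with hWdef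
  set g₁ := c₁ + κ₁ * (u₁ - T₁) + μ₁ * (n - 7 / 8) with hg₁def
  set g₂ := c₂ + κ₂ * (u₂ - T₂) + μ₂ * (n - 7 / 8) with hg₂def
  set g₃ := c₃ + κ₃ * (u₃ - T₃) + μ₃ * (n - 7 / 8) with hg₃def
  set g₄ := c₄ + κ₄ * (u₄ - T₄) + μ₄ * (n - 7 / 8) with hg₄def
  set S := a₁ / κ₁ * g₁ + a₂ / κ₂ * g₂ + a₃ / κ₃ * g₃ + a₄ / κ₄ * g₄ with hSdef
  have key : (a₁ / κ₁ * (c₁ + κ₁ * u₁) + a₂ / κ₂ * (c₂ + κ₂ * u₂) + a₃ / κ₃ * (c₃ + κ₃ * u₃) + a₄ / κ₄ * (c₄ + κ₄ * u₄) -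
        (a₁ * T₁ + a₂ * T₂ + a₃ * T₃ + a₄ * T₄)) / W -
      1 / W * ((a₁ * T₁ + a₂ * T₂ + a₃ * T₃ + a₄ * T₄) - (a₁ * T₁ + a₂ * T₂ + a₃ * T₃ + a₄ * T₄)) +
      (a₁ / κ₁ * μ₁ + a₂ / κ₂ * μ₂ + a₃ / κ₃ * μ₃ + a₄ / κ₄ * μ₄) / W * (n - 7 / 8) = S / W := by
    rw [hSdef, hg₁def, hg₂def, hg₃def, hg₄def]
    have f₁ : a₁ / κ₁ * (c₁ + κ₁ * u₁) = a₁ / κ₁ * c₁ + a₁ * u₁ := by field_simp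
    have f₂ : a₂ / κ₂ * (c₂ + κ₂ * u₂) = a₂ / κ₂ * c₂ + a₂ * u₂ := by field_simp
    have f₃ : a₃ / κ₃ * (c₃ + κ₃ * u₃) = a₃ / κ₃ * c₃ + a₃ * u₃ := by field_simp
    have f₄ : a₄ / κ₄ * (c₄ + κ₄ * u₄) = a₄ / κ₄ * c₄ + a₄ * u₄ := by field_simp
    have e₁ : a₁ / κ₁ * (c₁ + κ₁ * (u₁ - T₁) + μ₁ * (n - 7 / 8)) = a₁ / κ₁ * c₁ + a₁ * (u₁ - T₁) + a₁ / κ₁ * (μ₁ * (n - 7 / 8)) := by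
      field_simp
    have e₂ : a₂ / κ₂ * (c₂ + κ₂ * (u₂ - T₂) + μ₂ * (n - 7 / 8)) = a₂ / κ₂ * c₂ + a₂ * (u₂ - T₂) + a₂ / κ₂ * (μ₂ * (n - 7 / 8)) := by
      field_simp
    have e₃ : a₃ / κ₃ * (c₃ + κ₃ * (u₃ - T₃) + μ₃ * (n - 7 / 8)) = a₃ / κ₃ * c₃ + a₃ * (u₃ - T₃) + a₃ / κ₃ * (μ₃ * (n - 7 / 8)) := by
      field_simp
    have e₄ : a₄ / κ₄ * (c₄ + κ₄ * (u₄ - T₄) + μ₄ * (n - 7 / 8)) = a₄ / κ₄ * c₄ + a₄ * (u₄ - T₄) + a₄ / κ₄ * (μ₄ * (n - 7 / 8)) := by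
      field_simp
    have hWne : W ≠ 0 := ne_of_gt hW
    rw [f₁, f₂, f₃, f₄, e₁, e₂, e₃, e₄]
    field_simp
    ring
  rw [key]
  have t₁ := mul_le_mul_of_nonneg_left hg₁.1 hw₁
  have t₂ := mul_le_mul_of_nonneg_left hg₂.1 hw₂
  have t₃ := mul_le_mul_of_nonneg_left hg₃.1 hw₃
  have t₄ := mul_le_mul_of_nonneg_left hg₄.1 hw₄
  have t₁' := mul_le_mul_of_nonneg_left hg₁.2 hw₁
  have t₂' := mul_le_mul_of_nonneg_left hg₂.2 hw₂
  have t₃' := mul_le_mul_of_nonneg_left hg₃.2 hw₃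
  have t₄' := mul_le_mul_of_nonneg_left hg₄.2 hw₄
  have eW : m * W = a₁ / κ₁ * m + a₂ / κ₂ * m + a₃ / κ₃ * m + a₄ / κ₄ * m := by rw [hWdef]; ring
  have eW' : -m * W = a₁ / κ₁ * (-m) + a₂ / κ₂ * (-m) + a₃ / κ₃ * (-m) + a₄ / κ₄ * (-m) := by rw [hWdef]; ring
  have hSlo : -m * W ≤ S := by rw [eW', hSdef]; linarith
  have hShi : S ≤ m * W := by rw [eW, hSdef]; linarith
  have q1 : -m ≤ S / W := by rw [le_div_iff₀ hW]; exact hSlo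
  have q2 : S / W ≤ m := by rw [div_le_iff₀ hW]; exact hShi
  exact (sq_le_sq' q1 q2).trans hc'

/-- The transported twisted node constant in the dictionary `c = −M̃/s`, `κ = κ̃/s`, `μ₀ = λ̃/s` (`s = √2`): bounds on `−M̃ + κ̃(u − T) + λ̃d` pass
to `−M̃/s + (κ̃/s)(u − T) + (λ̃/s)d`. [cite: KomaTasaki1994, Theorem 5] -/
theorem transported_twisted_const_mem {M k u T l d B s : ℝ} (hs : 0 < s)
    (hlo : -B ≤ -M + k * (u - T) + l * d) (hhi : -M + k * (u - T) + l * d ≤ B) :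
    -(B / s) ≤ -M / s + k / s * (u - T) + l / s * d ∧ -M / s + k / s * (u - T) + l / s * d ≤ B / s := by
  have e : -M / s + k / s * (u - T) + l / s * d = (-M + k * (u - T) + l * d) / s := by ring
  rw [e, ← neg_div]
  exact ⟨div_le_div_of_nonneg_right hlo hs.le, div_le_div_of_nonneg_right hhi hs.le⟩

end Summit.Ventures.CertifiedManyBodySolver.Certificates

end
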